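import Summits.QuantumFields.YangMills.Theorems.BalabanUVNodesN07Lemma1CrossingBondsGauged
import Literature.MathematicalPhysics.QuantumFieldTheory.Balaban1983to89.B10StarCount
import HarnessLib

/-!
# DAG node N07 [B11] — piece 1b CAPSTONE: Lemma 1 of [6] (1.25) for the (0.4) averaging at the flat background, ALL bonds of the block pair
# `B(c₋) ∪ B(c₊)` in ONE gauge — within a block `≤ (d−1)(L−1)·a` ((155)'s within-block half), across `≤ dist1 (Ū c) + 7t + (d+1)(L−1)(d−1)(L−1)·a`
# ((160) case II), plus both log-datum shapes; the gauge is trivial at the block centres and moves no block average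

Cell `pub-ymgap` (HUMAN RULINGS D-0062 ∕ D-0149 ∕ D-0154), width seat `pub-ymgap-dag-n07-w5` g0, 2026-08-28.  `--kind proof --supports
stmt-QuantumFields-20542 --as helper` (K1⁷; count-neutral helper on the N07 [B11] row; dag-lead WIDTH-209 N07 piece 1b, DEDUP-382; seventh file of this seat,
composing p607031 · p608821 · p610424 · p610886 · p612118 by name).

THE PRINT.  [6] = T. Bałaban, CMP **99** (1985) 75–102 `[Balaban1985RegularSpaces]`, Lemma 1 (1.24)–(1.25) p. 79 «Then for α₀, α₁ small the configuration V′ is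
also small, more precisely we have the bound |V′ − 1| < 4d²α₀ + α₁ on Ω₁. (1.25)», proof p. 79 l. −6 – p. 80 l. 4 («|V′_b − 1| < (d−1)(L−1)2α₀L⁻² for b ⊂ B(y) …
for an arbitrary bond b ∈ B(c)»), (1.23) p. 79 «B(c) = {b ⊂ T : b₋ ∈ B(c₋), b₊ ∈ B(c₊)}»; [B11] = CMP **102** (1985) 277–309 `[Balaban1985Variational]`, (155) p. 302
«V₁ = e^{iB} with |B| < 18d²L³Mε₀» and (160) p. 303 «|B(x, x′)| < (8d²L² + 4L²|x − y|)ε₁»; [I] = CMP **109** (1987) 249–301 `[Balaban1987RG1]`, (0.3)–(0.4) pp. 252–253.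

WHAT THIS FILE DOES (kernel bookkeeping; nothing of [B11] ∕ [6] beyond Lemma 1's elementary counting is asserted).  Generic torus `P : Params`, standing
range, `SU(N)`.
* `dir_eq_of_blockOf_crossing` (any gauge group ∕ none: pure geometry) — a fine bond with `blockOf b₋ = c₋` and `blockOf b₊ = c₊` runs in the direction of `c`
  (`B10StarCount.blockOf_shift`: a unit step changes the block label only in its own direction; `N07Lemma1BlockGauge`-style `1 ≠ 0` on the coarse torus).
* ★★★ `exists_gauge_blockPair_bounds` — for every `U` on `T^{(j)}`: ∃ `g` with `g (emb y) = 1`, `avgFun ℰ (U^g) = avgFun ℰ U` for every small-loop average,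
  and for every coarse bond `c` whose three blocks `B(c₋ − e_μ) ∪ B(c₋) ∪ B(c₊)` carry `a`-small plaquettes with `t := ((d+2)L)²∕4·a < δ_N`:
  (within) every bond with both ends in `B(c₋)` or both in `B(c₊)` has `dist1 (U^g b) ≤ (d−1)(L−1)·a`;
  (across) every bond with `blockOf b₋ = c₋`, `blockOf b₊ = c₊` has `dist1 (U^g b) ≤ dist1 (Ū c) + 7t + (d+1)(L−1)(d−1)(L−1)·a` — (1.25) for EVERY `b ∈ B(c)` in
  print's sense (1.23), `α₁ = dist1 (Ū c)`, with the tree's constants for `4d²α₀`.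
* ★★ `norm_datum_blockPair_le` — both bounds in log-datum shape for a log-like `β` (`‖β g‖ ≤ C·dist1 g` on `dist1 g ≤ ρ`; the principal logarithm has `C = 2`,
  `ρ = ½`, `B11Eq160BondField.norm_fieldB_le`): print's (155) within-block «× 2» and (160) «|B(x₁, x′₁)| < 8d²L²ε₁ + |x − y|4L²ε₁» shapes.

HONEST FRAMING (binding).  Count-neutral helper; by-name composition of this seat's landed files; `a`, the guard and (at the record) the coarse smallness of
`Ū` are HYPOTHESES; the Λ′_j-CROSSING datum of (154)₂∕(155) on road R0′ is the SHEARED datum (rows (r0)∕(r4) of the lane, NOT here); constants are the tree's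
crude ones.  Tokens ∕ stub 1 ∕ K0⁷ ∕ K1⁷ NOT closed; N07 NOT discharged (5∕27 unmoved); one finite `T⁴` programme at fixed `ε`, Bałaban AS PRINTED — R4 closes
rung `BalabanLadder.UV` only; no summit statement is proved by this seat; NOT continuum ∕ ℝ⁴ ∕ OS ∕ mass gap ∕ Clay.  No `sorry`, no `def`, no `instance`, no `notation`.
-/

noncomputable section

namespace Summit.QuantumFields.YangMills.BalabanUVNodes.N07Lemma1BlockPairAllBonds

open Literature.MathematicalPhysics.QuantumFieldTheory.Balaban1983to89
open T4Continuum AveragingRT BlockAveraging ExpMeanLog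
open GaugeField (gaugeAct)
open N07Lemma1BlockGauge (exists_blockwiseGauge)
open N07Lemma1CrossingBonds (exists_offset_of_crossing)
open N07Lemma1CrossingBondsGauged (exists_gauge_crossingBond_le)

/-! ## §1  A bond from `B(c₋)` to `B(c₊)` runs along `c` -/

section Geometry

variable {P : Params} {j : ℕ}

/-- **A FINE BOND WITH `blockOf b₋ = c₋` AND `blockOf b₊ = c₊` RUNS IN THE DIRECTION OF `c`**: a unit step changes the block label only in its own direction
(`B10StarCount.blockOf_shift`), and `c₊ = c₋ + e_μ ≠ c₋` differs from `c₋` exactly in the coordinate `μ`. [cite: Balaban1985RegularSpaces, (1.23) p.79] -/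
theorem dir_eq_of_blockOf_crossing (hj : j + 1 ≤ P.m + P.K) (c : PBond P (j + 1)) (b : PBond P j) (hsrc : blockOf b.src = c.src)
    (htgt : blockOf b.tgt = c.tgt) : b.dir = c.dir := by
  by_contra hne
  have h := B10StarCount.blockOf_shift hj b.src b.dir
  rw [← PBond.tgt, htgt, hsrc] at h
  -- compare the coordinate `c.dir`
  have hc := congrFun h c.dir
  rw [PBond.tgt, Site.shift_apply, if_pos rfl] at hc
  split_ifs at hc with htop
  · rw [Site.shift_apply, if_neg (Ne.symm hne)] at hc
    have h2 : (1 : ZMod (P.sitesPerDir (j + 1))) = 0 := by linear_combination hc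
    exact one_ne_zero h2
  · have h2 : (1 : ZMod (P.sitesPerDir (j + 1))) = 0 := by linear_combination hc
    exact one_ne_zero h2

end Geometry

/-! ## §2  Lemma 1 of [6] for the (0.4) averaging: all bonds of the block pair in one gauge -/

section SUN

open scoped Matrix.Norms.L2Operator

variable {n : Type*} [Fintype n] [DecidableEq n] [Nonempty n] {P : Params} {j : ℕ}

/-- ★★★ **LEMMA 1 OF [6] (1.25) FOR THE (0.4) AVERAGING AT THE FLAT BACKGROUND — ALL BONDS OF `B(c₋) ∪ B(c₊)` IN ONE GAUGE** (`SU(N)`, generic torus,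
standing range).  There is a gauge transformation `g`, trivial at every block centre and moving no block average, such that for every coarse bond `c`
whose three blocks carry `a`-small plaquettes (`t := ((d+2)L)²∕4·a < δ_N`): (within) both ends of `b` in `B(c₋)`, or both in `B(c₊)` ⇒
`dist1 (U^g b) ≤ (d−1)(L−1)·a`; (across) `blockOf b₋ = c₋`, `blockOf b₊ = c₊` ⇒ `dist1 (U^g b) ≤ dist1 (Ū c) + 7t + (d+1)(L−1)(d−1)(L−1)·a`, `Ū = avgFun expMeanLogSU U`.
[cite: Balaban1985RegularSpaces, Lemma 1 (1.24)-(1.25) p.79, p.80 l.1-4, (1.23) p.79; Balaban1987RG1, (0.4) p.253] -/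
theorem exists_gauge_blockPair_bounds (hj : j + 1 ≤ P.m + P.K) (U : GaugeField P j (Matrix.specialUnitaryGroup n ℂ)) :
    ∃ g : GaugeTransf P j (Matrix.specialUnitaryGroup n ℂ),
      (∀ y : Site P (j + 1), g (emb y) = 1) ∧
      (∀ ℰ : LoopAverage (Matrix.specialUnitaryGroup n ℂ), avgFun ℰ (gaugeAct g U) = avgFun ℰ U) ∧
      ∀ {a : ℝ}, 0 ≤ a → ∀ c : PBond P (j + 1),
        (∀ q : Plaq P j, (blockOf q.src = c.src.unshift c.dir ∨ blockOf q.src = c.src ∨ blockOf q.src = c.tgt) →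
          dist1 (GaugeField.plaqHol U q) < a) →
        ((((P.d + 2) * P.L : ℕ) : ℝ) ^ 2 / 4) * a < deltaSU n →
        (∀ b : PBond P j, blockOf b.src = blockOf b.tgt → (blockOf b.src = c.src ∨ blockOf b.src = c.tgt) →
            dist1 (gaugeAct g U b) ≤ (((P.d - 1 : ℕ) : ℝ) * ((P.L - 1 : ℕ) : ℝ)) * a) ∧
        ∀ b : PBond P j, blockOf b.src = c.src → blockOf b.tgt = c.tgt →
          dist1 (gaugeAct g U b) ≤
            dist1 (avgFun (expMeanLogSU (n := n)) U c) + 7 * (((((P.d + 2) * P.L : ℕ) : ℝ) ^ 2 / 4) * a) +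
              (((P.d + 1) * (P.L - 1) : ℕ) : ℝ) * ((((P.d - 1 : ℕ) : ℝ) * ((P.L - 1 : ℕ) : ℝ)) * a) := by
  -- the gauge of `exists_gauge_crossingBond_le` IS the block-wise gauge of `exists_blockwiseGauge`; re-derive both faces from the latter's witness
  obtain ⟨g, hcentre, hint, havg⟩ := exists_blockwiseGauge hj U
  refine ⟨g, hcentre, fun ℰ => havg (blockAvg ℰ), ?_⟩
  intro a ha c hU ht
  -- plaquette smallness is gauge invariant
  have hU' : ∀ q : Plaq P j, (blockOf q.src = c.src.unshift c.dir ∨ blockOf q.src = c.src ∨ blockOf q.src = c.tgt) →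
      dist1 (GaugeField.plaqHol (gaugeAct g U) q) < a := by
    intro q hq
    rw [T4ReTrLipUnitary.plaqHol_gaugeAct, GaugeGroup.dist1_conj]
    exact hU q hq
  have hwithin : ∀ b : PBond P j, blockOf b.src = blockOf b.tgt → (blockOf b.src = c.src ∨ blockOf b.src = c.tgt) →
      dist1 (gaugeAct g U b) ≤ (((P.d - 1 : ℕ) : ℝ) * ((P.L - 1 : ℕ) : ℝ)) * a := by
    intro b hb hbc
    rcases hbc with h | h
    · exact hint a ha c.src (fun q hq => hU q (Or.inr (Or.inl hq))) b h (hb ▸ h)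
    · exact hint a ha c.tgt (fun q hq => hU q (Or.inr (Or.inr hq))) b h (hb ▸ h)
  refine ⟨hwithin, fun b hsrc htgt => ?_⟩
  -- across: `b ∥ c`, `b = ⟨blockSite c₋ r, μ⟩` with `r_μ = L − 1`, then p610424's assembly for `U^g`
  have hdir : b.dir = c.dir := dir_eq_of_blockOf_crossing hj c b hsrc htgt
  have hne : blockOf b.tgt ≠ c.src := by
    rw [htgt, PBond.tgt]
    exact B6Ineq2123CentredTorus.shift_ne_self c.src c.dir
  obtain ⟨r, hr, hb⟩ := exists_offset_of_crossing hj c b hsrc hdir hne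
  have hτ : 0 ≤ (((P.d - 1 : ℕ) : ℝ) * ((P.L - 1 : ℕ) : ℝ)) * a := by positivity
  have hmain := N07Lemma1CrossingBondsAtRecord.dist1_crossingBond_le_avg_add ha hj c hU' ht hτ hwithin r hr
    (Equiv.refl _) (Equiv.refl _)
  have havg' : avgFun (expMeanLogSU (n := n)) (gaugeAct g U) c = avgFun (expMeanLogSU (n := n)) U c :=
    congrFun (havg (blockAvg (expMeanLogSU (n := n)))) c
  rw [havg'] at hmain
  rw [hb]
  exact hmain

/-- ★★ **BOTH BOUNDS IN LOG-DATUM SHAPE** ([B11] (155) within-block half «|B| < 18d²L³Mε₀ = (within-block count)·(plaquette letter)·2» and (160) case II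
«|B(x₁, x′₁)| < 8d²L²ε₁ + |x − y|4L²ε₁»): for a log-like `β` with `‖β h‖ ≤ C·dist1 h` on `dist1 h ≤ ρ` (the principal logarithm: `C = 2`, `ρ = ½`,
`B11Eq160BondField.norm_fieldB_le`), in the gauge of `exists_gauge_blockPair_bounds` the data `β(U^g b)` obey `≤ C·(d−1)(L−1)·a` within a block and
`≤ C·(dist1 (Ū c) + 7t + (d+1)(L−1)(d−1)(L−1)·a)` across, once those radii are `≤ ρ`. [cite: Balaban1985Variational, (155) p.302, (160) p.303] -/
theorem norm_datum_blockPair_le {E : Type*} [SeminormedAddCommGroup E] (β : Matrix.specialUnitaryGroup n ℂ → E) {C ρ : ℝ} (hC : 0 ≤ C)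
    (hβ : ∀ h : Matrix.specialUnitaryGroup n ℂ, dist1 h ≤ ρ → ‖β h‖ ≤ C * dist1 h)
    (hj : j + 1 ≤ P.m + P.K) (U : GaugeField P j (Matrix.specialUnitaryGroup n ℂ)) :
    ∃ g : GaugeTransf P j (Matrix.specialUnitaryGroup n ℂ),
      (∀ y : Site P (j + 1), g (emb y) = 1) ∧
      (∀ ℰ : LoopAverage (Matrix.specialUnitaryGroup n ℂ), avgFun ℰ (gaugeAct g U) = avgFun ℰ U) ∧
      ∀ {a : ℝ}, 0 ≤ a → ∀ c : PBond P (j + 1),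
        (∀ q : Plaq P j, (blockOf q.src = c.src.unshift c.dir ∨ blockOf q.src = c.src ∨ blockOf q.src = c.tgt) →
          dist1 (GaugeField.plaqHol U q) < a) →
        ((((P.d + 2) * P.L : ℕ) : ℝ) ^ 2 / 4) * a < deltaSU n →
        ((((P.d - 1 : ℕ) : ℝ) * ((P.L - 1 : ℕ) : ℝ)) * a ≤ ρ →
          ∀ b : PBond P j, blockOf b.src = blockOf b.tgt → (blockOf b.src = c.src ∨ blockOf b.src = c.tgt) →
            ‖β (gaugeAct g U b)‖ ≤ C * ((((P.d - 1 : ℕ) : ℝ) * ((P.L - 1 : ℕ) : ℝ)) * a)) ∧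
        (dist1 (avgFun (expMeanLogSU (n := n)) U c) + 7 * (((((P.d + 2) * P.L : ℕ) : ℝ) ^ 2 / 4) * a) +
              (((P.d + 1) * (P.L - 1) : ℕ) : ℝ) * ((((P.d - 1 : ℕ) : ℝ) * ((P.L - 1 : ℕ) : ℝ)) * a) ≤ ρ →
          ∀ b : PBond P j, blockOf b.src = c.src → blockOf b.tgt = c.tgt →
            ‖β (gaugeAct g U b)‖ ≤ C * (dist1 (avgFun (expMeanLogSU (n := n)) U c) + 7 * (((((P.d + 2) * P.L : ℕ) : ℝ) ^ 2 / 4) * a) +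
              (((P.d + 1) * (P.L - 1) : ℕ) : ℝ) * ((((P.d - 1 : ℕ) : ℝ) * ((P.L - 1 : ℕ) : ℝ)) * a))) := by
  obtain ⟨g, hcentre, havg, hbounds⟩ := exists_gauge_blockPair_bounds hj U
  refine ⟨g, hcentre, havg, ?_⟩
  intro a ha c hU ht
  obtain ⟨hwithin, hacross⟩ := hbounds ha c hU ht
  refine ⟨fun hρ b hb hbc => ?_, fun hρ b hsrc htgt => ?_⟩
  · have hd := hwithin b hb hbc
    exact (hβ _ (hd.trans hρ)).trans (mul_le_mul_of_nonneg_left hd hC)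
  · have hd := hacross b hsrc htgt
    exact (hβ _ (hd.trans hρ)).trans (mul_le_mul_of_nonneg_left hd hC)

end SUN

end Summit.QuantumFields.YangMills.BalabanUVNodes.N07Lemma1BlockPairAllBonds

end
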